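import Summits.CriticalPhenomena.PercolationContinuityZ3.Theorems.PercNearOneGluingNoHeavyQuantFarBlockTransfer
import HarnessLib

/-!
# QUANT lane R8, front "FAR beyond trees", layer one — ENVIRONMENT-AWARE block transfer: the exit certificate with the environment's
# coefficients `(A₀, B, C)` kept, and the mixed criterion

builds on p205010 (kernel theorem, internal audit signed; external expert review pending)

Support file (`--supports stmt-CriticalPhenomena-4575`), seat `prim-quant-p1` (gen 23); memo
`run/shared/lean/prim/quant/prim-quant-p1-g23/FOR-LEAD-CORESTEP.md` §6.  Standard axioms; no sorries; no definitions.

WHY.  `…QuantFarCoreBlockLocalityFalse` (this seat) shows that the ENVIRONMENT-AGNOSTIC criterion of `Block.real_card_le_one_le_of_dominates` (p1 g19: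
the block numbers `S = (h_S, t_S)` dominate a mixture of the comparison block's `(h', t')` and the exit point `(q, q)`) fails for junction cores such as the
pendant `K₂,₃` — by less than `0.2 %` of `q`, in environments where the observer reaches the cut vertex essentially only when no outside relay is reached.
The decomposition behind it (`Block.real_two_le_card_eq`, p1 g19): `P_w(N ≥ 2) = A₀ + B·h_S + C·t_S` with the ENVIRONMENT COEFFICIENTS
`A₀ = P(≥ 2 outside relays)`, `B = P(exactly one outside relay ∧ o ↔ c off Z)`, `C = P(no outside relay ∧ o ↔ c off Z)`, `A₀ + B + C ≥ g = P(o ↔ c off Z)`,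
and the cut of a block relay `a₀`: `1 − t ≤ g·τ₀`.  This file keeps `(A₀, B, C)` visible:
* `Block.real_card_le_one_le_of_envExit` — **`C·(τ₀ − t_S) ≤ A₀·(1 − τ₀) + B·(h_S − τ₀) ⟹ P_w(N ≤ 1) ≤ t`** (no comparison block at all; `t_S ≥ τ₀` is p1 g19's
  exit lemma; a junction core with `t_S` slightly below `τ₀` transfers in every environment with `(A₀ + B)/C ≥ (τ₀ − t_S)/(h_S − τ₀)`);
* `Block.real_card_le_one_le_of_envMix` — the mixed criterion: for a comparison block `w'` (agreeing off `Z`) with `P_{w'}(N ≤ 1) ≤ t` and some `λ ∈ [0,1]`,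
  `λ·[B(h' − h_S) + C(t' − t_S)] ≤ (1−λ)·[A₀(1 − τ₀) + B(h_S − τ₀) − C(τ₀ − t_S)] ⟹ P_w(N ≤ 1) ≤ t` (`λ`-mixture of the comparison certificate and the
  environment exit; `Block.real_card_le_one_le_of_dominates` is the special case that drops `A₀` and asks the inequality for ALL `(B, C) ≥ 0`).
[cite: Grimmett1999, §1.3 p. 10; §2.2] (product measure); the theorems [this work].
-/

noncomputable section

namespace Summit.CriticalPhenomena.PercolationContinuityZ3.Theorems

namespace Quant

namespace Block

open Finset MeasureTheory Set
open Literature.Probability.LatticeModels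
open Literature.Probability.Percolation
open Bundle (offZ avoid real_offZ_event_eq_of_agree)
open scoped Classical

variable {n : ℕ} {o c : Fin n} {Z : Finset (Fin n)}

/-- **ENVIRONMENT EXIT.**  Block `Z` at the cut vertex `c` (`o, c ∉ Z`, `w` vanishes between `Z` and `(Z ∪ {c})ᶜ`), relays `A`, environment coefficients
`A₀ = P(#out ≥ 2)`, `B = P(#out = 1 ∧ o ↔ c off Z)`, `C = P(#out = 0 ∧ o ↔ c off Z)`, block numbers `h_S = P(X ≥ 1)`, `t_S = P(X ≥ 2)`, and a block relay `a₀`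
with internal marginal `τ₀` and `P(o ↮ a₀) ≤ t`.  If `C·(τ₀ − t_S) ≤ A₀·(1 − τ₀) + B·(h_S − τ₀)` then `P_w(N ≤ 1) ≤ t`. [this work] -/
theorem real_card_le_one_le_of_envExit (w : Sym2 (Fin n) → unitInterval) (ho : o ∉ Z) (hc : c ∉ Z)
    (hw : ∀ x y : Fin n, x ≠ y → x ∈ Z → y ∉ Z → y ≠ c → (w s(x, y) : ℝ) = 0)
    (A : Finset (Fin n)) (t : ℝ) {a₀ : Fin n} (ha₀ : a₀ ∈ A ∩ Z)
    (hcut : (prodBernoulli w).real (openConn o a₀)ᶜ ≤ t)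
    (henv : (prodBernoulli w).real {ω | ((A \ Z).filter fun a => offZ Z ω ∈ openConn o a).card = 0 ∧ offZ Z ω ∈ openConn o c} *
        ((prodBernoulli w).real {ω | onZ Z ω ∈ openConn c a₀} -
          (prodBernoulli w).real {ω | 2 ≤ ((A ∩ Z).filter fun a => onZ Z ω ∈ openConn c a).card}) ≤
      (prodBernoulli w).real {ω | 2 ≤ ((A \ Z).filter fun a => offZ Z ω ∈ openConn o a).card} *
          (1 - (prodBernoulli w).real {ω | onZ Z ω ∈ openConn c a₀}) +
        (prodBernoulli w).real {ω | ((A \ Z).filter fun a => offZ Z ω ∈ openConn o a).card = 1 ∧ offZ Z ω ∈ openConn o c} *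
          ((prodBernoulli w).real {ω | 1 ≤ ((A ∩ Z).filter fun a => onZ Z ω ∈ openConn c a).card} -
            (prodBernoulli w).real {ω | onZ Z ω ∈ openConn c a₀})) :
    (prodBernoulli w).real {ω : BondConfig (Fin n) | (A.filter fun a => ω ∈ openConn o a).card ≤ 1} ≤ t := by
  set μ := prodBernoulli w with hμ
  have hmeas : ∀ U : Set (BondConfig (Fin n)), MeasurableSet U := fun U => (Set.toFinite U).measurableSet
  set A0 := μ.real {ω | 2 ≤ ((A \ Z).filter fun a => offZ Z ω ∈ openConn o a).card} with hA0
  set B := μ.real {ω | ((A \ Z).filter fun a => offZ Z ω ∈ openConn o a).card = 1 ∧ offZ Z ω ∈ openConn o c} with hB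
  set C := μ.real {ω | ((A \ Z).filter fun a => offZ Z ω ∈ openConn o a).card = 0 ∧ offZ Z ω ∈ openConn o c} with hC
  set hS := μ.real {ω | 1 ≤ ((A ∩ Z).filter fun a => onZ Z ω ∈ openConn c a).card} with hhS
  set tS := μ.real {ω | 2 ≤ ((A ∩ Z).filter fun a => onZ Z ω ∈ openConn c a).card} with htS
  set g := μ.real {ω | offZ Z ω ∈ openConn o c} with hg
  set τ₀ := μ.real {ω | onZ Z ω ∈ openConn c a₀} with hτ₀
  have hD : μ.real {ω : BondConfig (Fin n) | 2 ≤ (A.filter fun a => ω ∈ openConn o a).card} = A0 + B * hS + C * tS :=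
    real_two_le_card_eq w ho hc hw A
  have hJ : g ≤ A0 + B + C := real_inter_J_le μ (A \ Z)
  have hA00 : 0 ≤ A0 := measureReal_nonneg
  have hB0 : 0 ≤ B := measureReal_nonneg
  have hC0 : 0 ≤ C := measureReal_nonneg
  have hτ0 : 0 ≤ τ₀ := measureReal_nonneg
  have hτ1 : τ₀ ≤ 1 := measureReal_le_one
  -- the cut of `a₀`: `1 − t ≤ g τ₀ ≤ (A0 + B + C) τ₀`
  have hmarg : μ.real (openConn o a₀) = g * τ₀ := real_openConn_in_eq w ho hc hw (Finset.mem_inter.1 ha₀).2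
  have hca : μ.real (openConn o a₀ : Set (BondConfig (Fin n)))ᶜ = 1 - μ.real (openConn o a₀) := probReal_compl_eq_one_sub (hmeas _)
  have h1t : 1 - t ≤ (A0 + B + C) * τ₀ := by
    have e1 : 1 - t ≤ g * τ₀ := by rw [← hmarg]; linarith [hcut, hca]
    have e2 : g * τ₀ ≤ (A0 + B + C) * τ₀ := mul_le_mul_of_nonneg_right hJ hτ0
    linarith
  have hc2 : μ.real {ω : BondConfig (Fin n) | (A.filter fun a => ω ∈ openConn o a).card ≤ 1} =
      1 - μ.real {ω : BondConfig (Fin n) | 2 ≤ (A.filter fun a => ω ∈ openConn o a).card} := by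
    have : {ω : BondConfig (Fin n) | (A.filter fun a => ω ∈ openConn o a).card ≤ 1} =
        {ω : BondConfig (Fin n) | 2 ≤ (A.filter fun a => ω ∈ openConn o a).card}ᶜ := by
      ext ω; simp only [mem_setOf_eq, Set.mem_compl_iff]; omega
    rw [this, probReal_compl_eq_one_sub (hmeas _)]
  -- `A0 + B hS + C tS − (A0 + B + C) τ₀ = A0 (1 − τ₀) + B (hS − τ₀) − C (τ₀ − tS) ≥ 0`
  have key : (A0 + B + C) * τ₀ ≤ A0 + B * hS + C * tS := by nlinarith [henv]
  rw [hc2, hD]; linarith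

/-- **THE MIXED CRITERION.**  Same setting, plus a comparison block `w'` agreeing with `w` off `Z` (any internal structure) with `P_{w'}(N ≤ 1) ≤ t` and
internal numbers `(h', t')`.  If for some `λ ∈ [0,1]`: `λ·[B(h' − h_S) + C(t' − t_S)] ≤ (1 − λ)·[A₀(1 − τ₀) + B(h_S − τ₀) − C(τ₀ − t_S)]`, then
`P_w(N ≤ 1) ≤ t`.  (`λ = 0`: the environment exit; `Block.real_card_le_one_le_of_dominates` asks the `λ`-inequality with `A₀` dropped for all
`B, C ≥ 0` at once.) [this work] -/
theorem real_card_le_one_le_of_envMix (w w' : Sym2 (Fin n) → unitInterval) (ho : o ∉ Z) (hc : c ∉ Z)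
    (hw : ∀ x y : Fin n, x ≠ y → x ∈ Z → y ∉ Z → y ≠ c → (w s(x, y) : ℝ) = 0)
    (hw' : ∀ x y : Fin n, x ≠ y → x ∈ Z → y ∉ Z → y ≠ c → (w' s(x, y) : ℝ) = 0)
    (hagree : ∀ e ∈ avoid Z, w e = w' e)
    (A : Finset (Fin n)) (t lam : ℝ) (hlam0 : 0 ≤ lam) (hlam1 : lam ≤ 1) {a₀ : Fin n} (ha₀ : a₀ ∈ A ∩ Z)
    (hcut : (prodBernoulli w).real (openConn o a₀)ᶜ ≤ t)
    (hmix : lam * ((prodBernoulli w).real {ω | ((A \ Z).filter fun a => offZ Z ω ∈ openConn o a).card = 1 ∧ offZ Z ω ∈ openConn o c} *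
          ((prodBernoulli w').real {ω | 1 ≤ ((A ∩ Z).filter fun a => onZ Z ω ∈ openConn c a).card} -
            (prodBernoulli w).real {ω | 1 ≤ ((A ∩ Z).filter fun a => onZ Z ω ∈ openConn c a).card}) +
        (prodBernoulli w).real {ω | ((A \ Z).filter fun a => offZ Z ω ∈ openConn o a).card = 0 ∧ offZ Z ω ∈ openConn o c} *
          ((prodBernoulli w').real {ω | 2 ≤ ((A ∩ Z).filter fun a => onZ Z ω ∈ openConn c a).card} -
            (prodBernoulli w).real {ω | 2 ≤ ((A ∩ Z).filter fun a => onZ Z ω ∈ openConn c a).card})) ≤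
      (1 - lam) * ((prodBernoulli w).real {ω | 2 ≤ ((A \ Z).filter fun a => offZ Z ω ∈ openConn o a).card} *
          (1 - (prodBernoulli w).real {ω | onZ Z ω ∈ openConn c a₀}) +
        (prodBernoulli w).real {ω | ((A \ Z).filter fun a => offZ Z ω ∈ openConn o a).card = 1 ∧ offZ Z ω ∈ openConn o c} *
          ((prodBernoulli w).real {ω | 1 ≤ ((A ∩ Z).filter fun a => onZ Z ω ∈ openConn c a).card} -
            (prodBernoulli w).real {ω | onZ Z ω ∈ openConn c a₀}) -
        (prodBernoulli w).real {ω | ((A \ Z).filter fun a => offZ Z ω ∈ openConn o a).card = 0 ∧ offZ Z ω ∈ openConn o c} *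
          ((prodBernoulli w).real {ω | onZ Z ω ∈ openConn c a₀} -
            (prodBernoulli w).real {ω | 2 ≤ ((A ∩ Z).filter fun a => onZ Z ω ∈ openConn c a).card})))
    (hfar' : (prodBernoulli w').real {ω : BondConfig (Fin n) | (A.filter fun a => ω ∈ openConn o a).card ≤ 1} ≤ t) :
    (prodBernoulli w).real {ω : BondConfig (Fin n) | (A.filter fun a => ω ∈ openConn o a).card ≤ 1} ≤ t := by
  set μ := prodBernoulli w with hμ
  set μ' := prodBernoulli w' with hμ'
  have hmeas : ∀ U : Set (BondConfig (Fin n)), MeasurableSet U := fun U => (Set.toFinite U).measurableSet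
  set A0 := μ.real {ω | 2 ≤ ((A \ Z).filter fun a => offZ Z ω ∈ openConn o a).card} with hA0
  set B := μ.real {ω | ((A \ Z).filter fun a => offZ Z ω ∈ openConn o a).card = 1 ∧ offZ Z ω ∈ openConn o c} with hB
  set C := μ.real {ω | ((A \ Z).filter fun a => offZ Z ω ∈ openConn o a).card = 0 ∧ offZ Z ω ∈ openConn o c} with hC
  set hS := μ.real {ω | 1 ≤ ((A ∩ Z).filter fun a => onZ Z ω ∈ openConn c a).card} with hhS
  set tS := μ.real {ω | 2 ≤ ((A ∩ Z).filter fun a => onZ Z ω ∈ openConn c a).card} with htS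
  set hP := μ'.real {ω | 1 ≤ ((A ∩ Z).filter fun a => onZ Z ω ∈ openConn c a).card} with hhP
  set tP := μ'.real {ω | 2 ≤ ((A ∩ Z).filter fun a => onZ Z ω ∈ openConn c a).card} with htP
  set g := μ.real {ω | offZ Z ω ∈ openConn o c} with hg
  set τ₀ := μ.real {ω | onZ Z ω ∈ openConn c a₀} with hτ₀
  have hD : μ.real {ω : BondConfig (Fin n) | 2 ≤ (A.filter fun a => ω ∈ openConn o a).card} = A0 + B * hS + C * tS :=
    real_two_le_card_eq w ho hc hw A
  have hD' : μ'.real {ω : BondConfig (Fin n) | 2 ≤ (A.filter fun a => ω ∈ openConn o a).card} = A0 + B * hP + C * tP := by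
    have h := real_two_le_card_eq w' ho hc hw' A
    have e1 := real_offZ_event_eq_of_agree w w' Z hagree (fun η => 2 ≤ ((A \ Z).filter fun a => η ∈ openConn o a).card)
    have e2 := real_offZ_event_eq_of_agree w w' Z hagree
      (fun η => ((A \ Z).filter fun a => η ∈ openConn o a).card = 1 ∧ η ∈ openConn o c)
    have e3 := real_offZ_event_eq_of_agree w w' Z hagree
      (fun η => ((A \ Z).filter fun a => η ∈ openConn o a).card = 0 ∧ η ∈ openConn o c)
    rw [hA0, hB, hC, hhP, htP, e1, e2, e3]
    exact h
  have hJ : g ≤ A0 + B + C := real_inter_J_le μ (A \ Z)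
  have hA00 : 0 ≤ A0 := measureReal_nonneg
  have hB0 : 0 ≤ B := measureReal_nonneg
  have hC0 : 0 ≤ C := measureReal_nonneg
  have hτ0 : 0 ≤ τ₀ := measureReal_nonneg
  have hcompl2 : ∀ (ν : Measure (BondConfig (Fin n))) [IsProbabilityMeasure ν],
      ν.real {ω : BondConfig (Fin n) | (A.filter fun a => ω ∈ openConn o a).card ≤ 1} =
        1 - ν.real {ω : BondConfig (Fin n) | 2 ≤ (A.filter fun a => ω ∈ openConn o a).card} := by
    intro ν _
    have : {ω : BondConfig (Fin n) | (A.filter fun a => ω ∈ openConn o a).card ≤ 1} =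
        {ω : BondConfig (Fin n) | 2 ≤ (A.filter fun a => ω ∈ openConn o a).card}ᶜ := by
      ext ω; simp only [mem_setOf_eq, Set.mem_compl_iff]; omega
    rw [this, probReal_compl_eq_one_sub (hmeas _)]
  -- certificate 1: comparison FAR
  have hfar2 : 1 - t ≤ A0 + B * hP + C * tP := by
    have := hcompl2 μ'
    rw [hD'] at this; linarith [hfar']
  -- certificate 2: environment exit
  have hmarg : μ.real (openConn o a₀) = g * τ₀ := real_openConn_in_eq w ho hc hw (Finset.mem_inter.1 ha₀).2
  have hca : μ.real (openConn o a₀ : Set (BondConfig (Fin n)))ᶜ = 1 - μ.real (openConn o a₀) := probReal_compl_eq_one_sub (hmeas _)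
  have hex : 1 - t ≤ (A0 + B + C) * τ₀ := by
    have e1 : 1 - t ≤ g * τ₀ := by rw [← hmarg]; linarith [hcut, hca]
    have e2 : g * τ₀ ≤ (A0 + B + C) * τ₀ := mul_le_mul_of_nonneg_right hJ hτ0
    linarith
  -- mix
  have hge : 1 - t ≤ A0 + B * hS + C * tS := by
    have e1 : lam * (1 - t) ≤ lam * (A0 + B * hP + C * tP) := mul_le_mul_of_nonneg_left hfar2 hlam0
    have e2 : (1 - lam) * (1 - t) ≤ (1 - lam) * ((A0 + B + C) * τ₀) := mul_le_mul_of_nonneg_left hex (by linarith)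
    nlinarith [hmix, e1, e2]
  rw [hcompl2 μ, hD]; linarith

end Block

end Quant

end Summit.CriticalPhenomena.PercolationContinuityZ3.Theorems
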